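import Literature.AnabelianGeometry.AbsoluteAnabelian.AbsTopIII.ReconstructionCor110iiPrime
import Literature.AnabelianGeometry.AbsoluteAnabelian.AbsAnabProp121viiKummerTransportProofs
import Literature.NumberTheory.GaloisRepresentations.GaloisCohomologyKummerProofs
import HarnessLib

/-!
# [AbsTopIII] Cor. 1.10 (i)(b) natural form — transport of Kummer theory along `(α, ψ̄)` (bricks for reading (N))

Mochizuki, *Topics in Absolute Anabelian Geometry III*, Cor. 1.10 (i)(b) p. 42 («functorial "group-theoretic"
algorithm … `H¹(G_k, μ_Ẑ(G_k)) ⥲ G_k^ab`») with [AbsAnab] Prop. 1.2.1 (vi)/(vii) p. 10–11 (the units transport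
`ψ̄ : k̄₁ˣ ⥲ k̄₂ˣ` attached to `α : G_{k₁} ≅ G_{k₂}`).  abc-iut layer L4, row «Cor110ii-PRIME» (abc-iut-L4-d1); used
by `ReconstructionCor110iiPrimeNaturalProofs.lean` (`AbsTopIII.cor_1_10_i_b_natural_holds`).  For an
isomorphism of topological groups `α : G_{k₁} ≃ₜ* G_{k₂}` and an `α`-EQUIVARIANT `ψ̄ : k̄₁ˣ ⥲ k̄₂ˣ`:

* `cohTransport_kummerMap` — level-`n` Kummer naturality: the transport along `(α, ψ̄|μ_n)` carries the Kummer
  class `δ_n(a₁)` to `δ_n(a₂)` when `ψ̄ a₁ = a₂`;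
* `tateModuleMap` / `tateModuleResHom` — `Λ(ψ̄) : Ẑ(1)(k̄₁) → Ẑ(1)(k̄₂)` as a morphism of topological
  `G_{k₂}`-representations `res_{α⁻¹} Ẑ(1)(k̄₁) ⟶ Ẑ(1)(k̄₂)`, and `cohomologyMap_projHom_map_tateModuleResHom`:
  the level coordinates of `H¹(α; Λ(ψ̄))` are the level-`n` transports;
* `tateModuleMap_toTateModule`, `cohomologyMap_galCyclotomeH1Map` — for coefficient identifications
  `φᵢ : μ_{ℚ/ℤ}(G_{kᵢ}) ≅ μ(k̄ᵢ)` COMPATIBLE under `(α, ψ̄)`, abc-iut-L4-t11's `μ_Ẑ(G_{kᵢ}) ⥲ Ẑ(1)(k̄ᵢ)`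
  intertwine `μ_Ẑ(α)` (on abc-iut-L4-t1's group-theoretic cyclotome) with `Λ(ψ̄)`, also on `H¹`;
* `completionMap` (`ψ̂`), `proj_completionMap` — the profinite completion of a homomorphism `ψ₀ : A → B` and its
  power components; `equivCompletion_map_tateModuleResHom` — under abc-iut-L4-t11's
  `Cᵢ : H¹(G_{kᵢ}, Ẑ(1)) ≃ (kᵢˣ)^∧`, `H¹(α; Λ(ψ̄))` IS the completion `ψ̂` of `ψ₀ = ψ̄|_{k₁ˣ}`.

Definitions with bodies and theorems (no named fact, no `sorry`).  HONEST FRAMING: classical Kummer theory /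
profinite groups; nothing here bears on [IUTchIII] Cor. 3.12 or takes a side.
-/

noncomputable section

open CategoryTheory Function
open Field ValuativeRel

universe u

namespace Literature.AnabelianGeometry.AbsoluteAnabelian

open _root_.TopRep _root_.ContRepresentation _root_.ContinuousCohomology
open Literature.NumberTheory.GaloisRepresentations
open Literature.NumberTheory.GaloisRepresentations.DiscreteGaloisModule
open ProfiniteGrp ProfiniteGrp.ProfiniteCompletion

namespace Cor110iiPrime

section KummerLevel

variable {k₁ k₂ : Type u} [Field k₁] [Field k₂]

/-- `μ_n`-coefficient transport on underlying units: `ι (ψ̄|μ_n m) = ψ̄ (ι m)`.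
[cite: MochizukiAbsAnab2004, Prop 1.2.1 (vi) p.10] -/
theorem muVal_muCarrierMap (ψ : (AlgebraicClosure k₁)ˣ ≃* (AlgebraicClosure k₂)ˣ) (n : ℕ)
    (m : MuCarrier k₁ n) :
    muVal k₂ n (Prop121vii.muCarrierMap ψ.toMonoidHom n m) = ψ (muVal k₁ n m) :=
  rfl

/-- **Level-`n` Kummer naturality under an `α`-equivariant `ψ̄ : k̄₁ˣ ⥲ k̄₂ˣ`**: the degree-`1` transport
along `(α, ψ̄|μ_n)` carries the Kummer class `δ_n(a₁)` (`kummerMap`) to `δ_n(a₂)` whenever `ψ̄ (a₁) = a₂`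
on the images in `k̄ᵢˣ` (the transported Kummer cocycle of a root `r` of `a₁` is the Kummer cocycle of
the root `ψ̄ r` of `a₂`; [AbsAnab] Prop. 1.2.1 (vii) proof p. 11 step N1, «group-theoretic, by (iii)»,
at level `n`). [cite: MochizukiAbsAnab2004, Prop 1.2.1 (vii) p.11] -/
theorem cohTransport_kummerMap (α : absoluteGaloisGroup k₁ ≃ₜ* absoluteGaloisGroup k₂)
    (ψ : (AlgebraicClosure k₁)ˣ ≃* (AlgebraicClosure k₂)ˣ) (hψ : Prop121vii.IsAlphaEquivariant α ψ)
    (n : ℕ) [NeZero (n : k₁)] [NeZero (n : k₂)] (a₁ : k₁ˣ) (a₂ : k₂ˣ)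
    (ha : ψ (Units.map (algebraMap k₁ (AlgebraicClosure k₁) : k₁ →* AlgebraicClosure k₁) a₁) =
      Units.map (algebraMap k₂ (AlgebraicClosure k₂) : k₂ →* AlgebraicClosure k₂) a₂) :
    Prop121vii.cohTransport α (mu k₁ n) (mu k₂ n) (Prop121vii.muCarrierMap ψ.toMonoidHom n)
        (Prop121vii.isEquivariantOver_muCarrierMap hψ n) 1 (Multiplicative.toAdd (kummerMap k₁ n a₁)) =
      Multiplicative.toAdd (kummerMap k₂ n a₂) := by
  set r : kummerUnits k₁ n := kummerUnitsRoot k₁ n a₁ with hr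
  -- the transported cocycle
  obtain ⟨c₂, hc₂, hT⟩ := Prop121vii.cohTransport_oneCocycleClass α (mu k₁ n) (mu k₂ n)
    (Prop121vii.muCarrierMap ψ.toMonoidHom n) (Prop121vii.isEquivariantOver_muCarrierMap hψ n)
    (kummerOneCocycle k₁ n r)
  -- `ψ̄ r` is a Kummer unit of level `n` over `k₂`, with `n`-th power `a₂`
  have hpow : (ψ (r : (AlgebraicClosure k₁)ˣ)) ^ n =
      Units.map (algebraMap k₂ (AlgebraicClosure k₂) : k₂ →* AlgebraicClosure k₂) a₂ := by
    rw [← map_pow, hr, kummerUnitsRoot_pow, ha]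
  have hβ : ψ (r : (AlgebraicClosure k₁)ˣ) ∈ kummerUnits k₂ n := by
    intro σ
    rw [hpow]
    ext
    rw [Units.coe_smul, Units.coe_map, MonoidHom.coe_coe, smul_algebraMap]
  let β : kummerUnits k₂ n := ⟨ψ (r : (AlgebraicClosure k₁)ˣ), hβ⟩
  -- the transported cocycle IS the Kummer cocycle of `β`
  have hcoc : c₂ = kummerOneCocycle k₂ n β := by
    refine Subtype.ext (ContinuousMap.ext fun σ₂ => muVal_injective k₂ n ?_)
    rw [hc₂ σ₂, muVal_muCarrierMap, kummerOneCocycle_apply, kummerOneCocycle_apply,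
      muVal_kummerOneCocycleFun, muVal_kummerOneCocycleFun, map_div, hψ, ContinuousMulEquiv.apply_symm_apply]
  -- Kummer classes only depend on the `n`-th power
  have hcl := kummerClassHom_eq_of_pow_eq k₂ n (α := β) (β := kummerUnitsRoot k₂ n a₂)
    (by rw [kummerUnitsRoot_pow]; exact hpow)
  rw [kummerClassHom_apply, kummerClassHom_apply] at hcl
  change Prop121vii.cohTransport α (mu k₁ n) (mu k₂ n) (Prop121vii.muCarrierMap ψ.toMonoidHom n)
      (Prop121vii.isEquivariantOver_muCarrierMap hψ n) 1 (oneCocycleClass (mu k₁ n).toTopRep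
        (kummerOneCocycle k₁ n r)) =
    oneCocycleClass (mu k₂ n).toTopRep (kummerOneCocycle k₂ n (kummerUnitsRoot k₂ n a₂))
  rw [hT, hcoc]
  exact Multiplicative.ofAdd.injective hcl

end KummerLevel

/-! ### `Λ(ψ̄)` on the Tate modules `Ẑ(1)(k̄ᵢ) = lim_n μ_n(k̄ᵢ)` -/

section TateTransport

variable {k₁ k₂ : Type u} [Field k₁] [Field k₂]

/-- **`Λ(ψ̄) : Ẑ(1)(k̄₁) → Ẑ(1)(k̄₂)`** — an isomorphism `ψ̄ : k̄₁ˣ ⥲ k̄₂ˣ` applied componentwise to compatible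
systems of roots of unity (it commutes with the power maps). [cite: MochizukiAbsAnab2004, Prop 1.2.1 (vi) p.10] -/
def tateModuleMap (ψ : (AlgebraicClosure k₁)ˣ ≃* (AlgebraicClosure k₂)ˣ) :
    (muSystem k₁).limit →+ (muSystem k₂).limit where
  toFun x := ⟨fun n => Prop121vii.muCarrierMap ψ.toMonoidHom n ((x : ∀ n : ℕ+, MuCarrier k₁ n) n),
    fun n m h => muVal_injective k₂ n (by
      rw [muSystem_red, muVal_muPowMap, muVal_muCarrierMap, muVal_muCarrierMap, ← map_pow,
        ← muVal_muPowMap k₁ h, ← muSystem_red k₁ h, DiscreteInvSystem.red_apply_coe])⟩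
  map_zero' := Subtype.ext (funext fun n => by simp)
  map_add' x y := Subtype.ext (funext fun n => by simp)

/-- Coordinates of `tateModuleMap`. [cite: MochizukiAbsAnab2004, Prop 1.2.1 (vi) p.10] -/
@[simp] theorem coe_tateModuleMap_apply (ψ : (AlgebraicClosure k₁)ˣ ≃* (AlgebraicClosure k₂)ˣ)
    (x : (muSystem k₁).limit) (n : ℕ+) :
    (tateModuleMap ψ x : ∀ n : ℕ+, MuCarrier k₂ n) n =
      Prop121vii.muCarrierMap ψ.toMonoidHom n ((x : ∀ n : ℕ+, MuCarrier k₁ n) n) :=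
  rfl

/-- `Λ(ψ̄)` is continuous (componentwise maps between discrete levels).
[cite: MochizukiAbsAnab2004, Prop 1.2.1 (vi) p.10] -/
theorem continuous_tateModuleMap (ψ : (AlgebraicClosure k₁)ˣ ≃* (AlgebraicClosure k₂)ˣ) :
    Continuous (tateModuleMap ψ) := by
  have h : Continuous fun x : (muSystem k₁).limit =>
      ((tateModuleMap ψ x : (muSystem k₂).limit) : ∀ n : ℕ+, MuCarrier k₂ n) :=
    continuous_pi fun n => (continuous_of_discreteTopology (f := Prop121vii.muCarrierMap ψ.toMonoidHom n)).comp
      ((continuous_apply n).comp continuous_subtype_val)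
  exact continuous_induced_rng.2 h

/-- **`Λ(ψ̄)` as a morphism of topological `G_{k₂}`-representations** `res_{α⁻¹} Ẑ(1)(k̄₁) ⟶ Ẑ(1)(k̄₂)` for an
`α`-EQUIVARIANT `ψ̄` (`G_{k₂}` acting on `Ẑ(1)(k̄₁)` through `α⁻¹`).
[cite: MochizukiAbsAnab2004, Prop 1.2.1 (vi) p.10] -/
def tateModuleResHom (α : absoluteGaloisGroup k₁ ≃ₜ* absoluteGaloisGroup k₂)
    (ψ : (AlgebraicClosure k₁)ˣ ≃* (AlgebraicClosure k₂)ˣ) (hψ : Prop121vii.IsAlphaEquivariant α ψ) :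
    TopRep.res ((α.symm : absoluteGaloisGroup k₂ →ₜ* absoluteGaloisGroup k₁) :
        absoluteGaloisGroup k₂ →* absoluteGaloisGroup k₁) (tateModuleMu k₁).toTopRep ⟶
      (tateModuleMu k₂).toTopRep :=
  TopRep.ofHom ⟨⟨(tateModuleMap ψ).toIntLinearMap, continuous_tateModuleMap ψ⟩, fun g₂ =>
    ContinuousLinearMap.ext fun x => Subtype.ext (funext fun n => by
      change Prop121vii.muCarrierMap ψ.toMonoidHom n
          (((tateModuleMu k₁) (α.symm g₂) x : ∀ n : ℕ+, MuCarrier k₁ n) n) =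
        ((tateModuleMu k₂) g₂ (tateModuleMap ψ x) : ∀ n : ℕ+, MuCarrier k₂ n) n
      rw [DiscreteInvSystem.coe_limitRep_apply, DiscreteInvSystem.coe_limitRep_apply, muSystem_ρ,
        muSystem_ρ, coe_tateModuleMap_apply, Prop121vii.isEquivariantOver_muCarrierMap hψ n,
        ContinuousMulEquiv.apply_symm_apply])⟩

/-- `tateModuleResHom` on elements. [cite: MochizukiAbsAnab2004, Prop 1.2.1 (vi) p.10] -/
@[simp] theorem tateModuleResHom_hom_apply (α : absoluteGaloisGroup k₁ ≃ₜ* absoluteGaloisGroup k₂)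
    (ψ : (AlgebraicClosure k₁)ˣ ≃* (AlgebraicClosure k₂)ˣ) (hψ : Prop121vii.IsAlphaEquivariant α ψ)
    (x : (muSystem k₁).limit) :
    (tateModuleResHom α ψ hψ).hom x = tateModuleMap ψ x :=
  rfl

/-- **Level coordinates of `H¹(α; Λ(ψ̄))`**: the `n`-th projection of the transported class is the level-`n`
transport (`Prop121vii.cohTransport` along `(α, ψ̄|μ_n)`) of the `n`-th projection.
[cite: MochizukiAbsAnab2004, Prop 1.2.1 (vii) p.11] -/
theorem cohomologyMap_projHom_map_tateModuleResHom (α : absoluteGaloisGroup k₁ ≃ₜ* absoluteGaloisGroup k₂)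
    (ψ : (AlgebraicClosure k₁)ˣ ≃* (AlgebraicClosure k₂)ˣ) (hψ : Prop121vii.IsAlphaEquivariant α ψ)
    (y : continuousCohomology 1 (tateModuleMu k₁).toTopRep) (n : ℕ+) :
    cohomologyMap ((muSystem k₂).projHom n) 1
        (ContinuousCohomology.map (α.symm : absoluteGaloisGroup k₂ →ₜ* absoluteGaloisGroup k₁)
          (tateModuleResHom α ψ hψ) 1 y) =
      Prop121vii.cohTransport α (mu k₁ n) (mu k₂ n) (Prop121vii.muCarrierMap ψ.toMonoidHom n)
        (Prop121vii.isEquivariantOver_muCarrierMap hψ n) 1 (cohomologyMap ((muSystem k₁).projHom n) 1 y) := by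
  obtain ⟨c, rfl⟩ := oneCocycleClass_surjective _ y
  obtain ⟨c₂, hc₂, hT⟩ := Prop121vii.cohTransport_oneCocycleClass α (mu k₁ n) (mu k₂ n)
    (Prop121vii.muCarrierMap ψ.toMonoidHom n) (Prop121vii.isEquivariantOver_muCarrierMap hψ n)
    (contOneCocycles.pullback (ContinuousMonoidHom.id _) (resIdHom ((muSystem k₁).projHom n)) c)
  rw [(muSystem k₁).cohomologyMap_projHom_oneCocycleClass, map_oneCocycleClass, cohomologyMap_oneCocycleClass]
  change _ = Prop121vii.cohTransport α (mu k₁ n) (mu k₂ n) (Prop121vii.muCarrierMap ψ.toMonoidHom n)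
    (Prop121vii.isEquivariantOver_muCarrierMap hψ n) 1 (oneCocycleClass _
      (contOneCocycles.pullback (ContinuousMonoidHom.id _) (resIdHom ((muSystem k₁).projHom n)) c))
  rw [hT]
  congr 1
  exact Subtype.ext (ContinuousMap.ext fun σ₂ => (hc₂ σ₂).symm)

end TateTransport

/-! ### The square `H¹(φ₂) ∘ H¹(α; μ_Ẑ(α)) = H¹(α; Λ(ψ̄)) ∘ H¹(φ₁)` -/

section CyclotomeSquare

variable {k₁ k₂ : Type u} [Field k₁] [CharZero k₁] [Field k₂] [CharZero k₂]
  (α : absoluteGaloisGroup k₁ ≃ₜ* absoluteGaloisGroup k₂)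
  (ψ : (AlgebraicClosure k₁)ˣ ≃* (AlgebraicClosure k₂)ˣ) (hψ : Prop121vii.IsAlphaEquivariant α ψ)
  (φ₁ : muQZ (absoluteGaloisGroup k₁) ≃+ Additive (CommGroup.torsion (AlgebraicClosure k₁)ˣ))
  (hφ₁ : ∀ (σ : absoluteGaloisGroup k₁) (x : muQZ (absoluteGaloisGroup k₁)),
      (((Additive.toMul (φ₁ (σ • x)) : CommGroup.torsion (AlgebraicClosure k₁)ˣ) :
          (AlgebraicClosure k₁)ˣ) : AlgebraicClosure k₁) =
        σ • (((Additive.toMul (φ₁ x) : CommGroup.torsion (AlgebraicClosure k₁)ˣ) :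
          (AlgebraicClosure k₁)ˣ) : AlgebraicClosure k₁))
  (φ₂ : muQZ (absoluteGaloisGroup k₂) ≃+ Additive (CommGroup.torsion (AlgebraicClosure k₂)ˣ))
  (hφ₂ : ∀ (σ : absoluteGaloisGroup k₂) (x : muQZ (absoluteGaloisGroup k₂)),
      (((Additive.toMul (φ₂ (σ • x)) : CommGroup.torsion (AlgebraicClosure k₂)ˣ) :
          (AlgebraicClosure k₂)ˣ) : AlgebraicClosure k₂) =
        σ • (((Additive.toMul (φ₂ x) : CommGroup.torsion (AlgebraicClosure k₂)ˣ) :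
          (AlgebraicClosure k₂)ˣ) : AlgebraicClosure k₂))
  (hφ : ∀ z : muQZ (absoluteGaloisGroup k₁),
    ((Additive.toMul (φ₂ (muQZ.map α z)) : CommGroup.torsion (AlgebraicClosure k₂)ˣ) :
        (AlgebraicClosure k₂)ˣ) =
      ψ ((Additive.toMul (φ₁ z) : CommGroup.torsion (AlgebraicClosure k₁)ˣ) : (AlgebraicClosure k₁)ˣ))

include hφ in
/-- **The square of topological representations**: for coefficient identifications `φᵢ : μ_{ℚ/ℤ}(G_{kᵢ}) ≅ μ(k̄ᵢ)`
COMPATIBLE under `(α, ψ̄)` (`φ₂ ∘ μ_{ℚ/ℤ}(α) = ψ̄ ∘ φ₁`, [AbsAnab] Prop. 1.2.1 (vi)), abc-iut-L4-t11's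
`μ_Ẑ(G_{kᵢ}) ⥲ Ẑ(1)(k̄ᵢ)` intertwine `μ_Ẑ(α)` with `Λ(ψ̄)`. [cite: MochizukiAbsAnab2004, Prop 1.2.1 (vi) p.10] -/
theorem tateModuleMap_toTateModule (m : MuZhatMod (absoluteGaloisGroup k₁)) :
    tateModuleMap ψ (toTateModule k₁ φ₁ m) = toTateModule k₂ φ₂ (MuZhatMod.congrL α m) := by
  refine Subtype.ext (funext fun n => muVal_injective k₂ n ?_)
  rw [coe_tateModuleMap_apply, muVal_muCarrierMap, muVal_toTateModule, muVal_toTateModule]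
  unfold levelUnit
  rw [MuZhatMod.toMuZhat_congrL, muZhat.map_apply_coe, toAdd_ofAdd, hφ]

/-- `H¹(α; μ_Ẑ(α))` on the class of a crossed homomorphism `c`: the class of `μ_Ẑ(α) ∘ c ∘ α⁻¹`.
[cite: MochizukiAbsTopIII2015, Cor 1.10 (i) p.42] -/
theorem galCyclotomeH1Map_oneCocycleClass
    (c : contOneCocycles (galCyclotomeTopRep (absoluteGaloisGroup k₁))) :
    galCyclotomeH1Map α (oneCocycleClass _ c) =
      oneCocycleClass _ (contOneCocycles.pullback
        (α.symm : absoluteGaloisGroup k₂ →ₜ* absoluteGaloisGroup k₁) (galCyclotomeResHom α) c) :=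
  map_oneCocycleClass _ _ _ c

omit [CharZero k₂] in
/-- `H¹` of abc-iut-L4-t11's `galCyclotomeIsoTateModule` on the class of a crossed homomorphism.
[cite: MochizukiAbsTopIII2015, Cor 1.10 (i) p.42] -/
theorem cohomologyMap_galCyclotomeIsoTateModule_oneCocycleClass
    (c : contOneCocycles (galCyclotomeTopRep (absoluteGaloisGroup k₁))) :
    (cohomologyMap (galCyclotomeIsoTateModule k₁ φ₁ hφ₁).hom 1).hom (oneCocycleClass _ c) =
      oneCocycleClass _ (contOneCocycles.pullback (ContinuousMonoidHom.id _)
        (resIdHom (galCyclotomeIsoTateModule k₁ φ₁ hφ₁).hom) c) :=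
  cohomologyMap_oneCocycleClass _ c

omit [CharZero k₂] in
/-- abc-iut-L4-t11's `galCyclotomeIsoTateModule` on elements is `toTateModule`.
[cite: MochizukiAbsTopIII2015, Cor 1.10 (i) p.42] -/
theorem galCyclotomeIsoTateModule_hom_apply (m : MuZhatMod (absoluteGaloisGroup k₁)) :
    (galCyclotomeIsoTateModule k₁ φ₁ hφ₁).hom.hom m = toTateModule k₁ φ₁ m :=
  rfl

include hφ in
/-- **`H¹(φ₂) ∘ H¹(α; μ_Ẑ(α)) = H¹(α; Λ(ψ̄)) ∘ H¹(φ₁)`** on `H¹(G_{k₁}, μ_Ẑ(G_{k₁}))`, for compatible `φ₁, φ₂`.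
[cite: MochizukiAbsTopIII2015, Cor 1.10 (i) p.42] -/
theorem cohomologyMap_galCyclotomeH1Map (y : galCyclotomeH1 (absoluteGaloisGroup k₁)) :
    (cohomologyMap (galCyclotomeIsoTateModule k₂ φ₂ hφ₂).hom 1).hom (galCyclotomeH1Map α y) =
      ContinuousCohomology.map (α.symm : absoluteGaloisGroup k₂ →ₜ* absoluteGaloisGroup k₁)
        (tateModuleResHom α ψ hψ) 1 ((cohomologyMap (galCyclotomeIsoTateModule k₁ φ₁ hφ₁).hom 1).hom y) := by
  obtain ⟨c, rfl⟩ := oneCocycleClass_surjective _ y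
  rw [galCyclotomeH1Map_oneCocycleClass, cohomologyMap_galCyclotomeIsoTateModule_oneCocycleClass,
    cohomologyMap_galCyclotomeIsoTateModule_oneCocycleClass, map_oneCocycleClass]
  congr 1
  refine Subtype.ext (ContinuousMap.ext fun σ₂ => ?_)
  rw [contOneCocycles.pullback_apply, contOneCocycles.pullback_apply, contOneCocycles.pullback_apply,
    contOneCocycles.pullback_apply, resIdHom_hom_apply, resIdHom_hom_apply, tateModuleResHom_hom_apply,
    galCyclotomeIsoTateModule_hom_apply, galCyclotomeIsoTateModule_hom_apply]
  change toTateModule k₂ φ₂ (MuZhatMod.congrL α (c.1 (α.symm σ₂))) = _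
  rw [tateModuleMap_toTateModule α ψ φ₁ φ₂ hφ]
  rfl

end CyclotomeSquare

/-! ### Functoriality of the profinite completion `(kˣ)^∧` in a homomorphism `ψ₀ : k₁ˣ → k₂ˣ` -/

section CompletionMap

variable {A B : Type u} [CommGroup A] [CommGroup B] (ψ₀ : A →* B)

/-- `ψ̂ : Â → B̂`, the map of profinite completions induced by `ψ₀ : A → B` (Mathlib's universal
property `ProfiniteCompletion.lift` applied to `η_B ∘ ψ₀`). [cite: RibesZalesskii2010, Thm 2.7.1] -/
def completionMap : completion (GrpCat.of A) ⟶ completion (GrpCat.of B) :=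
  lift (GrpCat.ofHom ψ₀ ≫ eta (GrpCat.of B))

/-- `ψ̂ ∘ η_A = η_B ∘ ψ₀`. [cite: RibesZalesskii2010, Thm 2.7.1] -/
theorem completionMap_eta (a : A) :
    (completionMap ψ₀).hom ((eta (GrpCat.of A)).hom a) = (eta (GrpCat.of B)).hom (ψ₀ a) := by
  have h := ConcreteCategory.congr_hom (lift_eta (GrpCat.ofHom ψ₀ ≫ eta (GrpCat.of B))) a
  exact h

/-- `ψ̂` is continuous. [cite: RibesZalesskii2010, Thm 2.7.1] -/
theorem continuous_completionMap : Continuous (completionMap ψ₀).hom :=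
  (completionMap ψ₀).hom.continuous_toFun

variable (hA : ∀ n : ℕ+, ((powMonoidHom (n : ℕ) : A →* A).range).FiniteIndex)
  (hB : ∀ n : ℕ+, ((powMonoidHom (n : ℕ) : B →* B).range).FiniteIndex)

omit hB in
/-- The power components `Â → A/Aⁿ` are continuous (`A/Aⁿ` discrete). [cite: RibesZalesskii2010, Thm 2.7.1] -/
theorem continuous_proj (n : ℕ+) :
    @Continuous _ (A ⧸ (powMonoidHom (n : ℕ) : A →* A).range) _ ⊥ (PowCompletion.proj hA n) :=
  ((ProfiniteGrp.limitCone (diagram (GrpCat.of A))).π.app (PowCompletion.powLevel hA n)).hom.continuous_toFun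

/-- **Power components of `ψ̂`**: `proj_n (ψ̂ z) = ψ₀ (proj_n z) mod Bⁿ` — both sides are continuous in `z`
with discrete target and agree on the dense image of `A`. [cite: RibesZalesskii2010, Thm 2.7.1] -/
theorem proj_completionMap (n : ℕ+) (z : completion (GrpCat.of A)) :
    PowCompletion.proj hB n ((completionMap ψ₀).hom z) =
      QuotientGroup.map _ _ ψ₀ (fun a ha => by
        obtain ⟨c, rfl⟩ := ha
        exact ⟨ψ₀ c, by rw [powMonoidHom_apply, powMonoidHom_apply, map_pow]⟩) (PowCompletion.proj hA n z) := by
  letI : TopologicalSpace (B ⧸ (powMonoidHom (n : ℕ) : B →* B).range) := ⊥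
  haveI : DiscreteTopology (B ⧸ (powMonoidHom (n : ℕ) : B →* B).range) := ⟨rfl⟩
  letI : TopologicalSpace (A ⧸ (powMonoidHom (n : ℕ) : A →* A).range) := ⊥
  haveI : DiscreteTopology (A ⧸ (powMonoidHom (n : ℕ) : A →* A).range) := ⟨rfl⟩
  have key : (fun z : completion (GrpCat.of A) => PowCompletion.proj hB n ((completionMap ψ₀).hom z)) =
      fun z => QuotientGroup.map _ _ ψ₀ (fun a ha => by
        obtain ⟨c, rfl⟩ := ha
        exact ⟨ψ₀ c, by rw [powMonoidHom_apply, powMonoidHom_apply, map_pow]⟩) (PowCompletion.proj hA n z) := by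
    refine (denseRange (G := GrpCat.of A)).equalizer ?_ ?_ ?_
    · exact (continuous_proj hB n).comp (continuous_completionMap ψ₀)
    · exact continuous_of_discreteTopology.comp (continuous_proj hA n)
    · funext a
      change PowCompletion.proj hB n ((completionMap ψ₀).hom ((eta (GrpCat.of A)).hom a)) =
        QuotientGroup.map _ _ ψ₀ _ (PowCompletion.proj hA n ((eta (GrpCat.of A)).hom a))
      rw [completionMap_eta]
      rfl
  exact congrFun key z

end CompletionMap

/-! ### `H¹(α; Λ(ψ̄))` read on `(kᵢˣ)^∧` is `ψ̂` -/

section CompletionSquare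

variable {k₁ k₂ : Type u} [Field k₁] [CharZero k₁] [Field k₂] [CharZero k₂]
  (α : absoluteGaloisGroup k₁ ≃ₜ* absoluteGaloisGroup k₂)
  (ψ : (AlgebraicClosure k₁)ˣ ≃* (AlgebraicClosure k₂)ˣ) (hψ : Prop121vii.IsAlphaEquivariant α ψ)
  (ψ₀ : k₁ˣ →* k₂ˣ)
  (hψ₀ : ∀ a : k₁ˣ, ψ (Units.map (algebraMap k₁ (AlgebraicClosure k₁) : k₁ →* AlgebraicClosure k₁) a) =
    Units.map (algebraMap k₂ (AlgebraicClosure k₂) : k₂ →* AlgebraicClosure k₂) (ψ₀ a))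
  (hfin₁ : ∀ n : ℕ+, ((powMonoidHom (n : ℕ) : k₁ˣ →* k₁ˣ).range).FiniteIndex)
  (hfin₂ : ∀ n : ℕ+, ((powMonoidHom (n : ℕ) : k₂ˣ →* k₂ˣ).range).FiniteIndex)

/-- The power component of `C(w) ∈ (kˣ)^∧` is read off the level-`n` coordinate of `w ∈ H¹(G_k, Ẑ(1))`:
`δ_n (proj_n (C w)) = H¹(proj_n) w` (definition of abc-iut-L4-t11's `C`, levelwise the Kummer isomorphisms).
[cite: SerreGaloisCohomology1997, II §1.2] -/
theorem kummerLift_proj_equivCompletion (w : continuousCohomology 1 (tateModuleMu k₂).toTopRep) (n : ℕ+) :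
    Multiplicative.toAdd (kummerLift k₂ n (PowCompletion.proj hfin₂ n
        (Additive.toMul (continuousCohomologyOneTateModuleEquivCompletion k₂ hfin₂ w)))) =
      cohomologyMap ((muSystem k₂).projHom n) 1 w := by
  set q := Additive.toMul (continuousCohomologyOneTateModuleEquivCompletion k₂ hfin₂ w) with hq
  have hK : completionUnitsEquivCohomologyLimitMu k₂ hfin₂ q =
      Multiplicative.ofAdd (continuousCohomologyOneTateModuleEquiv k₂ w) := by
    rw [hq]
    change completionUnitsEquivCohomologyLimitMu k₂ hfin₂ ((completionUnitsEquivCohomologyLimitMu k₂ hfin₂).symm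
      (Multiplicative.ofAdd (continuousCohomologyOneTateModuleEquiv k₂ w))) = _
    rw [MulEquiv.apply_symm_apply]
  have h := congrArg (fun t : Multiplicative ((muSystem k₂).cohomologyLimit 1) =>
    ((Multiplicative.toAdd t : (muSystem k₂).cohomologyLimit 1) :
      ∀ n, continuousCohomology 1 ((muSystem k₂).ρ n).toTopRep) n) hK
  simp only [toAdd_ofAdd, continuousCohomologyOneTateModuleEquiv,
    DiscreteInvSystem.coe_continuousCohomologyOneLimitEquiv_apply] at h
  rw [← h]
  exact completionUnitsToCohomologyLimit_apply k₂ hfin₂ q n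

include hψ₀ in
/-- **`C₂ ∘ H¹(α; Λ(ψ̄)) = ψ̂ ∘ C₁`**: under abc-iut-L4-t11's identifications `Cᵢ : H¹(G_{kᵢ}, Ẑ(1)) ≃ (kᵢˣ)^∧`
the transport along `(α, Λ(ψ̄))` is the completion `ψ̂` of `ψ₀ = ψ̄|_{k₁ˣ}` (componentwise: level-`n` Kummer
naturality `cohTransport_kummerMap` and the power components of `ψ̂`).
[cite: MochizukiAbsAnab2004, Prop 1.2.1 (vii) p.11] -/
theorem equivCompletion_map_tateModuleResHom (y : continuousCohomology 1 (tateModuleMu k₁).toTopRep) :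
    Additive.toMul (continuousCohomologyOneTateModuleEquivCompletion k₂ hfin₂
        (ContinuousCohomology.map (α.symm : absoluteGaloisGroup k₂ →ₜ* absoluteGaloisGroup k₁)
          (tateModuleResHom α ψ hψ) 1 y)) =
      (completionMap ψ₀).hom (Additive.toMul (continuousCohomologyOneTateModuleEquivCompletion k₁ hfin₁ y)) := by
  refine PowCompletion.ext_of_proj hfin₂ fun n => ?_
  haveI : NeZero ((n : ℕ) : k₁) := NeZero.charZero
  haveI : NeZero ((n : ℕ) : k₂) := NeZero.charZero
  set z := Additive.toMul (continuousCohomologyOneTateModuleEquivCompletion k₁ hfin₁ y) with hz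
  obtain ⟨a, ha⟩ := QuotientGroup.mk_surjective (PowCompletion.proj hfin₁ n z)
  -- the right-hand side
  rw [proj_completionMap ψ₀ hfin₁ hfin₂ n z, ← ha]
  change _ = QuotientGroup.mk (ψ₀ a)
  -- the left-hand side, through the injective Kummer map at level `n`
  apply (kummerLift_bijective k₂ n).1
  apply Multiplicative.toAdd.injective
  rw [kummerLift_proj_equivCompletion, cohomologyMap_projHom_map_tateModuleResHom, kummerLift_mk]
  have h₁ : cohomologyMap ((muSystem k₁).projHom n) 1 y = Multiplicative.toAdd (kummerMap k₁ n a) := by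
    rw [← kummerLift_mk, ha, hz, kummerLift_proj_equivCompletion]
  rw [h₁]
  exact cohTransport_kummerMap α ψ hψ n a (ψ₀ a) (hψ₀ a)

end CompletionSquare

end Cor110iiPrime

end Literature.AnabelianGeometry.AbsoluteAnabelian
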